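import Literature.NumberTheory.DiophantineGeometry.SquarefulSumsDetMethod
import Literature.NumberTheory.DiophantineGeometry.SquarefulSumsCountingTools

-- Summit.ABC.ABC is the mandated summit-side namespace (single-conjunct summit); the lakefile sets the same option tree-wide.
set_option linter.dupNamespace false

/-!
# Roots of unity modulo `m` and the fibre count of the determinant tool (crux stmt-ABC-2757, helpers of stub `detTool`)

Helper file for stub S2 (`detTool`, the determinant method for the shape count `B_d` at one
coordinate) of the line `fibre-toolkit-lp-wall-map` for the crux
`Summit.ABC.ABC.Theses.TwistAmplification.MazurKaneLaw`.  It supplies the two self-contained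
inputs of that stub which do not mention shape tuples:

* `detToolRoots` (registered helper sub-goal): for `m, n ≥ 1` the `n`-th roots of unity in
  `ZMod m` number at most `(2n)^{ω(m)}`.  Odd prime powers have cyclic unit groups (`≤ n`,
  `SquarefulCount.natCard_rootsOfUnity_primePow_le`); modulo `2^j` the bound `≤ 2n` is a coset
  count: for `j ≤ 2` the unit group is cyclic, and for `j ≥ 3` the cyclic subgroup generated by `5`
  has order `2^{j-2}` (`ZMod.orderOf_five`), hence index `2`, and the `n`-torsion of a finite abelian
  group meets each coset of a subgroup `H` in at most `#H[n]` elements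
  (`natCard_torsion_le_index_mul`); the Chinese remainder theorem glues
  (`SquarefulCount.natCard_rootsOfUnity_mul_le`).  With `2n ≤ 2^n ` and `2^{ω(m)} ≤ τ(m)` this gives
  the per-modulus bound `≤ τ(m)^{n}` used by the stub (`natCard_rootsOfUnity_le_pow`).
* `tripleCount_le`: the elementary determinant method `SquarefulDet.fiberBound` specialised to one
  fibre of the shape count: for positive `A, B, C`, a prime `p ∤ (n+1)ABC` and a box with
  `48 X₀Y₀Z₀ < ABC p³`, the `(x, y, z) ∈ [0,2X₀) × [0,2Y₀) × [0,2Z₀)` with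
  `A x^{n+1} + B y^{n+1} = C z^{n+1}` and `gcd(A x^{n+1}, B y^{n+1}) = 1` number at most
  `2(n+2) · 3(n+1)p · ∏_{m ∈ {A,B,C}} #{ρ ∈ ZMod m : ρ^{n+1} = 1}` (inject `(x,y,z) ↦ (x,y,z) ∈ ℤ³`;
  all coprimality side conditions of `fiberBound` follow from the single gcd condition and the
  equation).

No new definitions; everything here is folklore bookkeeping around results already in the tree.
-/

namespace Summit.ABC.ABC.Theorems.MazurKaneLaw

open Finset
open Literature.NumberTheory.DiophantineGeometry

/-! ### Torsion in a finite abelian group versus a subgroup -/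

/-- In a finite commutative group `G` with a subgroup `H`, the `n`-torsion of `G` has at most
`[G : H] · #{h ∈ H : hⁿ = 1}` elements (the `n`-torsion subgroup `T` has `#T = [T : T ∩ H] · #(T ∩ H)`
and `[T : T ∩ H] ∣ [G : H]`). [folklore] -/
theorem natCard_torsion_le_index_mul {G : Type*} [CommGroup G] [Finite G] (H : Subgroup G) (n : ℕ) :
    Nat.card {g : G // g ^ n = 1} ≤ H.index * Nat.card {h : H // h ^ n = 1} := by
  set T : Subgroup G := (powMonoidHom n : G →* G).ker with hT
  have hmemT : ∀ g : G, g ∈ T ↔ g ^ n = 1 := fun g => by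
    rw [hT, MonoidHom.mem_ker, powMonoidHom_apply]
  have h1 : Nat.card {g : G // g ^ n = 1} = Nat.card T :=
    Nat.card_congr (Equiv.subtypeEquivRight fun g => (hmemT g).symm)
  have h2 : Nat.card (H.subgroupOf T) * H.relIndex T = Nat.card T := Subgroup.card_mul_index _
  have h3 : H.relIndex T ≤ H.index :=
    Nat.le_of_dvd (Nat.pos_of_ne_zero Subgroup.index_ne_zero_of_finite)
      (Subgroup.relIndex_dvd_index_of_normal H T)
  have h4 : Nat.card (H.subgroupOf T) ≤ Nat.card {h : H // h ^ n = 1} := by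
    refine Nat.card_le_card_of_injective
      (fun x => ⟨⟨((x : T) : G), Subgroup.mem_subgroupOf.mp x.2⟩, ?_⟩) ?_
    · have hx : ((x : T) : G) ^ n = 1 := (hmemT _).mp (x : T).2
      exact Subtype.ext (by simpa using hx)
    · intro x y hxy
      have := congrArg (fun z : {h : H // h ^ n = 1} => ((z.1 : H) : G)) hxy
      exact Subtype.ext (Subtype.ext (by simpa using this))
  calc Nat.card {g : G // g ^ n = 1} = Nat.card T := h1
    _ = Nat.card (H.subgroupOf T) * H.relIndex T := h2.symm
    _ ≤ Nat.card {h : H // h ^ n = 1} * H.index := Nat.mul_le_mul h4 h3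
    _ = H.index * Nat.card {h : H // h ^ n = 1} := Nat.mul_comm _ _

/-- In a finite cyclic group the `n`-torsion (`n ≥ 1`) has at most `n` elements
(`IsCyclic.card_pow_eq_one_le`, restated with `Nat.card`). [folklore] -/
theorem natCard_torsion_le_of_isCyclic (K : Type*) [CommGroup K] [Finite K] [IsCyclic K] {n : ℕ}
    (hn : 0 < n) : Nat.card {u : K // u ^ n = 1} ≤ n := by
  classical
  haveI := Fintype.ofFinite K
  rw [Nat.card_eq_fintype_card, Fintype.card_subtype]
  exact IsCyclic.card_pow_eq_one_le hn

/-! ### Roots of unity modulo powers of two, and modulo `m` -/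

/-- Modulo `2^j` the `n`-th roots of unity (`n ≥ 1`) number at most `2n`: for `j ≤ 2` the unit group
is cyclic; for `j ≥ 3` the unit `5` generates a cyclic subgroup of order `2^{j-2}`
(`ZMod.orderOf_five`), i.e. of index `2` in the `2^{j-1}` units, and the `n`-torsion meets each of
its two cosets in at most `n` elements. [folklore] -/
theorem natCard_rootsOfUnity_two_pow_le (j : ℕ) {n : ℕ} (hn : 0 < n) :
    Nat.card {ρ : ZMod (2 ^ j) // ρ ^ n = 1} ≤ 2 * n := by
  classical
  haveI : NeZero (2 ^ j) := ⟨pow_ne_zero _ two_ne_zero⟩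
  refine (SquarefulCount.natCard_rootsOfUnity_le_units hn.ne').trans ?_
  rcases le_or_gt j 2 with hj | hj
  · haveI := (ZMod.isCyclic_units_two_pow_iff j).mpr hj
    exact (natCard_torsion_le_of_isCyclic (ZMod (2 ^ j))ˣ hn).trans (by omega)
  · obtain ⟨k, rfl⟩ : ∃ k, j = k + 3 := ⟨j - 3, by omega⟩
    have h5 : IsUnit (5 : ZMod (2 ^ (k + 3))) := by
      rw [show (5 : ZMod (2 ^ (k + 3))) = ((5 : ℕ) : ZMod (2 ^ (k + 3))) by norm_cast,
        ZMod.isUnit_iff_coprime]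
      exact Nat.Coprime.pow_right _ (by norm_num)
    set g : (ZMod (2 ^ (k + 3)))ˣ := h5.unit with hg
    have hord : orderOf g = 2 ^ (k + 1) := by
      rw [← orderOf_injective _ Units.coeHom_injective g, Units.coeHom_apply, hg, IsUnit.unit_spec]
      exact ZMod.orderOf_five (k + 1)
    set H : Subgroup (ZMod (2 ^ (k + 3)))ˣ := Subgroup.zpowers g with hH
    have hHcard : Nat.card H = 2 ^ (k + 1) := by rw [hH, Nat.card_zpowers, hord]
    have hG : Nat.card (ZMod (2 ^ (k + 3)))ˣ = 2 ^ (k + 1) * 2 := by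
      rw [Nat.card_eq_fintype_card, ZMod.card_units_eq_totient,
        Nat.totient_prime_pow Nat.prime_two (by omega)]
      simp [pow_succ]
    have hidx : H.index = 2 := by
      have h := H.card_mul_index
      rw [hHcard, hG] at h
      exact Nat.eq_of_mul_eq_mul_left (pow_pos two_pos _) h
    calc Nat.card {u : (ZMod (2 ^ (k + 3)))ˣ // u ^ n = 1}
        ≤ H.index * Nat.card {h : H // h ^ n = 1} := natCard_torsion_le_index_mul H n
      _ ≤ 2 * n := by rw [hidx]; exact Nat.mul_le_mul_left 2 (natCard_torsion_le_of_isCyclic H hn)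

/-- **Roots of unity modulo `m`** (registered helper sub-goal of stub `detTool`): for `m, n ≥ 1` the
`n`-th roots of unity in `ZMod m` number at most `(2n)^{ω(m)}` — Chinese remainder theorem, cyclic
unit groups modulo odd prime powers (`≤ n`), and `natCard_rootsOfUnity_two_pow_le` modulo `2^j`
(`≤ 2n`). [folklore] -/
theorem detToolRoots : ∀ m n : ℕ, 0 < m → 0 < n → Nat.card {ρ : ZMod m // ρ ^ n = 1} ≤ (2 * n) ^ m.primeFactors.card := by
  intro m n hm hn
  induction m using Nat.recOnPosPrimePosCoprime with
  | zero => exact absurd hm (lt_irrefl 0)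
  | one =>
    rw [Nat.primeFactors_one, Finset.card_empty, pow_zero]
    exact (Finite.card_subtype_le _).trans (by rw [Nat.card_zmod])
  | prime_pow q j hq hj =>
    rw [Nat.primeFactors_prime_pow hj.ne' hq, Finset.card_singleton, pow_one]
    by_cases hq2 : q = 2
    · subst hq2
      exact natCard_rootsOfUnity_two_pow_le j hn
    · exact (SquarefulCount.natCard_rootsOfUnity_primePow_le hq hq2 hn).trans (by omega)
  | coprime a b ha hb hab iha ihb =>
    haveI : NeZero a := ⟨by omega⟩
    haveI : NeZero b := ⟨by omega⟩
    rw [Nat.Coprime.primeFactors_mul hab, Finset.card_union_of_disjoint hab.disjoint_primeFactors,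
      pow_add]
    exact (SquarefulCount.natCard_rootsOfUnity_mul_le hab _).trans
      (Nat.mul_le_mul (iha (by omega)) (ihb (by omega)))

/-- The per-modulus bound of the determinant tool: if `m ≥ 1` has `τ(m) ≤ D` then the `(n+1)`-th
roots of unity in `ZMod m` number at most `D^{n+2}`
(`(2(n+1))^{ω(m)} ≤ (2^{n+1})^{ω(m)} = (2^{ω(m)})^{n+1} ≤ τ(m)^{n+1} ≤ D^{n+1} ≤ D^{n+2}`).
[folklore] -/
theorem natCard_rootsOfUnity_le_pow {m n D : ℕ} (hm : m ≠ 0) (hD : m.divisors.card ≤ D) :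
    Nat.card {ρ : ZMod m // ρ ^ (n + 1) = 1} ≤ D ^ (n + 2) := by
  have hD1 : 1 ≤ D := le_trans (Finset.card_pos.mpr ⟨1, Nat.one_mem_divisors.mpr hm⟩) hD
  have h2 : 2 * (n + 1) ≤ 2 ^ (n + 1) := by
    rw [pow_succ']
    exact Nat.mul_le_mul_left 2 (Nat.succ_le_of_lt Nat.lt_two_pow_self)
  calc Nat.card {ρ : ZMod m // ρ ^ (n + 1) = 1} ≤ (2 * (n + 1)) ^ m.primeFactors.card :=
        detToolRoots m (n + 1) (Nat.pos_of_ne_zero hm) (Nat.succ_pos n)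
    _ ≤ (2 ^ (n + 1)) ^ m.primeFactors.card := Nat.pow_le_pow_left h2 _
    _ = (2 ^ m.primeFactors.card) ^ (n + 1) := by rw [← pow_mul, ← pow_mul, mul_comm]
    _ ≤ m.divisors.card ^ (n + 1) :=
        Nat.pow_le_pow_left (SquarefulCount.two_pow_card_primeFactors_le_card_divisors m hm) _
    _ ≤ D ^ (n + 1) := Nat.pow_le_pow_left hD _
    _ ≤ D ^ (n + 2) := Nat.pow_le_pow_right hD1 (by omega)

/-! ### One fibre of the shape count: the determinant method -/

/-- Bookkeeping: the product over `Fin 3` of the root counts modulo `Aⁱ` (`i = 1`) written out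
(the exponent `1` sits inside a type, so it is removed by generalising the moduli). [folklore] -/
theorem prod_natCard_roots_fin_three (A B C n : ℕ) :
    ∏ k : Fin 3, Nat.card {ρ : ZMod ((![A, B, C] : Fin 3 → ℕ) k ^ 1) // ρ ^ (n + 1) = 1} =
      Nat.card {ρ : ZMod A // ρ ^ (n + 1) = 1} * Nat.card {ρ : ZMod B // ρ ^ (n + 1) = 1} *
        Nat.card {ρ : ZMod C // ρ ^ (n + 1) = 1} := by
  have key : ∀ v : Fin 3 → ℕ, ∏ k : Fin 3, Nat.card {ρ : ZMod (v k ^ 1) // ρ ^ (n + 1) = 1} =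
      Nat.card {ρ : ZMod (v 0) // ρ ^ (n + 1) = 1} * Nat.card {ρ : ZMod (v 1) // ρ ^ (n + 1) = 1} *
        Nat.card {ρ : ZMod (v 2) // ρ ^ (n + 1) = 1} := by
    intro v
    simp only [Fin.prod_univ_three]
    rw [pow_one, pow_one, pow_one]
  exact key _

/-- Off-diagonal relations between two triples written with `![·, ·, ·]`. [folklore] -/
theorem fin3_offDiag {α β : Type*} {R : α → β → Prop} {a₀ a₁ a₂ : α} {b₀ b₁ b₂ : β}
    (h01 : R a₀ b₁) (h02 : R a₀ b₂) (h10 : R a₁ b₀) (h12 : R a₁ b₂) (h20 : R a₂ b₀)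
    (h21 : R a₂ b₁) : ∀ k l : Fin 3, k ≠ l → R (![a₀, a₁, a₂] k) (![b₀, b₁, b₂] l) := by
  intro k l hkl
  fin_cases k <;> fin_cases l <;> simp at hkl ⊢ <;> assumption

/-- **The fibre count of the determinant tool.** For `n ≥ 1`, positive `A, B, C`, a prime
`p ∤ (n+1)ABC` and `48 X₀Y₀Z₀ < ABC·p³`, the triples `(x, y, z)`, `x < 2X₀`, `y < 2Y₀`, `z < 2Z₀`,
with `A x^{n+1} + B y^{n+1} = C z^{n+1}` and `gcd(A x^{n+1}, B y^{n+1}) = 1` number at most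
`2(n+2) · 3(n+1)p · #μ_{n+1}(ZMod A) · #μ_{n+1}(ZMod B) · #μ_{n+1}(ZMod C)`.  This is
`SquarefulDet.fiberBound` with `e = 1`, moduli `(A, B, C)`, coefficients `(A, B, -C)` and box
`(2X₀, 2Y₀, 2Z₀)`: inside a solution the three terms are pairwise coprime (the third is the sum of
the first two), which yields every coprimality hypothesis of `fiberBound`. [folklore] -/
theorem tripleCount_le {n : ℕ} (hn : 1 ≤ n) {A B C : ℕ} (hA : 0 < A) (hB : 0 < B) (hC : 0 < C)
    {p : ℕ} (hp : p.Prime) (hpm : ¬ p ∣ (n + 1) * (A * B * C)) {X₀ Y₀ Z₀ : ℕ}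
    (hsize : 48 * (X₀ * Y₀ * Z₀) < A * B * C * p ^ 3) :
    ((Finset.range (2 * X₀) ×ˢ Finset.range (2 * Y₀) ×ˢ Finset.range (2 * Z₀)).filter
        fun t : ℕ × ℕ × ℕ => A * t.1 ^ (n + 1) + B * t.2.1 ^ (n + 1) = C * t.2.2 ^ (n + 1) ∧
          Nat.Coprime (A * t.1 ^ (n + 1)) (B * t.2.1 ^ (n + 1))).card
      ≤ 2 * (n + 2) * (3 * ((n + 1) * p)) *
        (Nat.card {ρ : ZMod A // ρ ^ (n + 1) = 1} * Nat.card {ρ : ZMod B // ρ ^ (n + 1) = 1} *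
          Nat.card {ρ : ZMod C // ρ ^ (n + 1) = 1}) := by
  classical
  set N := ((Finset.range (2 * X₀) ×ˢ Finset.range (2 * Y₀) ×ˢ Finset.range (2 * Z₀)).filter
        fun t : ℕ × ℕ × ℕ => A * t.1 ^ (n + 1) + B * t.2.1 ^ (n + 1) = C * t.2.2 ^ (n + 1) ∧
          Nat.Coprime (A * t.1 ^ (n + 1)) (B * t.2.1 ^ (n + 1))) with hN
  rcases N.eq_empty_or_nonempty with he | ⟨t₀, ht₀⟩
  · rw [he, card_empty]; exact Nat.zero_le _
  -- what membership means; the three terms are pairwise coprime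
  have hmem : ∀ t ∈ N, (t.1 < 2 * X₀ ∧ t.2.1 < 2 * Y₀ ∧ t.2.2 < 2 * Z₀) ∧
      A * t.1 ^ (n + 1) + B * t.2.1 ^ (n + 1) = C * t.2.2 ^ (n + 1) ∧
      Nat.Coprime (A * t.1 ^ (n + 1)) (B * t.2.1 ^ (n + 1)) ∧
      Nat.Coprime (A * t.1 ^ (n + 1)) (C * t.2.2 ^ (n + 1)) ∧
      Nat.Coprime (B * t.2.1 ^ (n + 1)) (C * t.2.2 ^ (n + 1)) := by
    intro t ht
    simp only [hN, mem_filter, mem_product, mem_range] at ht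
    obtain ⟨hbox, heq, hcop⟩ := ht
    refine ⟨hbox, heq, hcop, ?_, ?_⟩
    · rw [← heq]; exact Nat.coprime_self_add_right.mpr hcop
    · rw [← heq]; exact Nat.coprime_add_self_right.mpr hcop.symm
  have hdvd : ∀ (M u : ℕ), u ∣ M * u ^ (n + 1) := fun M u =>
    Dvd.dvd.mul_left (dvd_pow_self u (Nat.succ_ne_zero n)) M
  obtain ⟨-, -, h12, h13, h23⟩ := hmem t₀ ht₀
  have hAB : A.Coprime B := (h12.coprime_dvd_left (dvd_mul_right A _)).coprime_dvd_right (dvd_mul_right B _)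
  have hAC : A.Coprime C := (h13.coprime_dvd_left (dvd_mul_right A _)).coprime_dvd_right (dvd_mul_right C _)
  have hBC : B.Coprime C := (h23.coprime_dvd_left (dvd_mul_right B _)).coprime_dvd_right (dvd_mul_right C _)
  -- the data of `fiberBound`
  have hv0 : ∀ k, 0 < (![A, B, C] : Fin 3 → ℕ) k := by
    intro k; fin_cases k <;> assumption
  have hvc : ∀ k l, k ≠ l → ((![A, B, C] : Fin 3 → ℕ) k).Coprime ((![A, B, C] : Fin 3 → ℕ) l) :=
    fin3_offDiag hAB hAC hAB.symm hBC hAC.symm hBC.symm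
  have hc0 : ∀ k, (![(A : ℤ), (B : ℤ), -(C : ℤ)] : Fin 3 → ℤ) k ≠ 0 := by
    intro k; fin_cases k <;> simp <;> omega
  have hcv : ∀ k, (((![A, B, C] : Fin 3 → ℕ) k : ℤ) ^ 1) ∣ (![(A : ℤ), (B : ℤ), -(C : ℤ)] : Fin 3 → ℤ) k := by
    intro k; fin_cases k <;> simp
  have hZc : ∀ {a b : ℕ}, a.Coprime b → IsCoprime (a : ℤ) (b : ℤ) := fun h => Nat.isCoprime_iff_coprime.mpr h
  have hcu : ∀ k l, k ≠ l →
      IsCoprime ((![(A : ℤ), (B : ℤ), -(C : ℤ)] : Fin 3 → ℤ) k) (((![A, B, C] : Fin 3 → ℕ) l : ℕ) : ℤ) :=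
    fin3_offDiag (R := fun (a : ℤ) (b : ℕ) => IsCoprime a (b : ℤ)) (hZc hAB) (hZc hAC) (hZc hAB.symm)
      (hZc hBC) (hZc hAC.symm).neg_left (hZc hBC.symm).neg_left
  have hpd : ¬ p ∣ n + 1 := fun h => hpm (Dvd.dvd.mul_right h _)
  have hpA : ¬ p ∣ A := fun h => hpm (Dvd.dvd.mul_left (Dvd.dvd.mul_right (Dvd.dvd.mul_right h B) C) _)
  have hpB : ¬ p ∣ B := fun h => hpm (Dvd.dvd.mul_left (Dvd.dvd.mul_right (Dvd.dvd.mul_left h A) C) _)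
  have hpC : ¬ p ∣ C := fun h => hpm (Dvd.dvd.mul_left (Dvd.dvd.mul_left h (A * B)) _)
  have hpc : ∀ k, ¬ ((p : ℤ) ∣ (![(A : ℤ), (B : ℤ), -(C : ℤ)] : Fin 3 → ℤ) k) := by
    intro k; fin_cases k <;> simp [Int.natCast_dvd_natCast] <;> assumption
  have hpv : ∀ k, ¬ (p ∣ (![A, B, C] : Fin 3 → ℕ) k) := by
    intro k; fin_cases k <;> simp <;> assumption
  have hsize' : 6 * ((![2 * X₀, 2 * Y₀, 2 * Z₀] : Fin 3 → ℕ) 0 * (![2 * X₀, 2 * Y₀, 2 * Z₀] : Fin 3 → ℕ) 1 *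
      (![2 * X₀, 2 * Y₀, 2 * Z₀] : Fin 3 → ℕ) 2) <
      ((![A, B, C] : Fin 3 → ℕ) 0 * (![A, B, C] : Fin 3 → ℕ) 1 * (![A, B, C] : Fin 3 → ℕ) 2) ^ 1 * p ^ 3 := by
    simp only [Matrix.cons_val_zero, Matrix.cons_val_one, Matrix.cons_val_two, Matrix.head_cons,
      Matrix.tail_cons, pow_one]
    calc 6 * (2 * X₀ * (2 * Y₀) * (2 * Z₀)) = 48 * (X₀ * Y₀ * Z₀) := by ring
      _ < A * B * C * p ^ 3 := hsize
  have hfb := SquarefulDet.fiberBound (e := 1) hn ![A, B, C] hv0 hvc ![(A : ℤ), (B : ℤ), -(C : ℤ)] hc0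
    hcv hcu hp hpd hpc hpv ![2 * X₀, 2 * Y₀, 2 * Z₀] hsize'
  rw [prod_natCard_roots_fin_three] at hfb
  -- inject `N` into the set counted by `fiberBound`
  refine le_trans ?_ hfb
  refine card_le_card_of_injOn (fun t => (![(t.1 : ℤ), (t.2.1 : ℤ), (t.2.2 : ℤ)] : Fin 3 → ℤ))
    (fun t ht => ?_) (fun t ht t' ht' h => ?_)
  · obtain ⟨⟨hx, hy, hz⟩, heq, hc12, hc13, hc23⟩ := hmem t (mem_coe.mp ht)
    have hxy : t.1.Coprime t.2.1 := (hc12.coprime_dvd_left (hdvd A _)).coprime_dvd_right (hdvd B _)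
    have hxz : t.1.Coprime t.2.2 := (hc13.coprime_dvd_left (hdvd A _)).coprime_dvd_right (hdvd C _)
    have hyz : t.2.1.Coprime t.2.2 := (hc23.coprime_dvd_left (hdvd B _)).coprime_dvd_right (hdvd C _)
    have hxB : t.1.Coprime B := (hc12.coprime_dvd_left (hdvd A _)).coprime_dvd_right (dvd_mul_right B _)
    have hxC : t.1.Coprime C := (hc13.coprime_dvd_left (hdvd A _)).coprime_dvd_right (dvd_mul_right C _)
    have hyA : t.2.1.Coprime A := (hc12.symm.coprime_dvd_left (hdvd B _)).coprime_dvd_right (dvd_mul_right A _)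
    have hyC : t.2.1.Coprime C := (hc23.coprime_dvd_left (hdvd B _)).coprime_dvd_right (dvd_mul_right C _)
    have hzA : t.2.2.Coprime A := (hc13.symm.coprime_dvd_left (hdvd C _)).coprime_dvd_right (dvd_mul_right A _)
    have hzB : t.2.2.Coprime B := (hc23.symm.coprime_dvd_left (hdvd C _)).coprime_dvd_right (dvd_mul_right B _)
    rw [mem_coe, mem_filter, Fintype.mem_piFinset]
    refine ⟨?_, ?_, ?_, ?_⟩
    · intro k
      fin_cases k <;> simp only [Matrix.cons_val_zero, Matrix.cons_val_one, Matrix.cons_val_two,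
        Matrix.head_cons, Matrix.tail_cons, mem_Icc, Fin.zero_eta, Fin.mk_one, Fin.reduceFinMk] <;> omega
    · exact fin3_offDiag (hZc hxy) (hZc hxz) (hZc hxy.symm) (hZc hyz) (hZc hxz.symm) (hZc hyz.symm)
    · exact fin3_offDiag (R := fun (a : ℤ) (b : ℕ) => IsCoprime a (b : ℤ)) (hZc hxB) (hZc hxC)
        (hZc hyA) (hZc hyC) (hZc hzA) (hZc hzB)
    · have h := congrArg (fun m : ℕ => (m : ℤ)) heq
      push_cast at h
      simp only [Fin.sum_univ_three, Matrix.cons_val_zero, Matrix.cons_val_one, Matrix.cons_val_two,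
        Matrix.head_cons, Matrix.tail_cons]
      linear_combination h
  · have h0 := congrFun h 0
    have h1 := congrFun h 1
    have h2 := congrFun h 2
    simp only [Matrix.cons_val_zero, Matrix.cons_val_one, Matrix.cons_val_two, Matrix.head_cons,
      Matrix.tail_cons, Nat.cast_inj] at h0 h1 h2
    exact Prod.ext h0 (Prod.ext h1 h2)

/-- **The fibre bound of the determinant tool** (registered helper sub-goal of stub `detTool`):
`tripleCount_le` combined with the per-modulus root count `natCard_rootsOfUnity_le_pow`.  For
`n ≥ 1`, positive `A, B, C` with `τ(A), τ(B), τ(C) ≤ D`, a prime `p ∤ (n+1)ABC` and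
`48 X₀Y₀Z₀ < ABC·p³`, the `(x, y, z)`, `x < 2X₀`, `y < 2Y₀`, `z < 2Z₀`, with
`A x^{n+1} + B y^{n+1} = C z^{n+1}` and `gcd(A x^{n+1}, B y^{n+1}) = 1` number at most
`2(n+2) · 3(n+1)p · D^{3(n+2)}`. [folklore] -/
theorem detToolFibre : ∀ {n : ℕ}, 1 ≤ n → ∀ {A B C : ℕ}, 0 < A → 0 < B → 0 < C → ∀ {p : ℕ}, p.Prime → ¬ p ∣ (n + 1) * (A * B * C) → ∀ {X₀ Y₀ Z₀ : ℕ}, 48 * (X₀ * Y₀ * Z₀) < A * B * C * p ^ 3 → ∀ {D : ℕ}, A.divisors.card ≤ D → B.divisors.card ≤ D → C.divisors.card ≤ D → (Finset.filter (fun t : ℕ × ℕ × ℕ => A * t.1 ^ (n + 1) + B * t.2.1 ^ (n + 1) = C * t.2.2 ^ (n + 1) ∧ Nat.Coprime (A * t.1 ^ (n + 1)) (B * t.2.1 ^ (n + 1))) (Finset.range (2 * X₀) ×ˢ Finset.range (2 * Y₀) ×ˢ Finset.range (2 * Z₀))).card ≤ 2 * (n + 2) * (3 * ((n + 1) * p))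 * (D ^ (n + 2) * D ^ (n + 2) * D ^ (n + 2)) := by
  intro n hn A B C hA hB hC p hp hpm X₀ Y₀ Z₀ hsize D hDA hDB hDC
  exact (tripleCount_le hn hA hB hC hp hpm hsize).trans (Nat.mul_le_mul_left _
    (Nat.mul_le_mul (Nat.mul_le_mul (natCard_rootsOfUnity_le_pow hA.ne' hDA)
      (natCard_rootsOfUnity_le_pow hB.ne' hDB)) (natCard_rootsOfUnity_le_pow hC.ne' hDC)))

end Summit.ABC.ABC.Theorems.MazurKaneLaw
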